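import Summits.QuantumFields.BalabanUV.Beta.CovariantTowerDecay

/-!
# Beta / CovariantTowerL2 — an ℓ² OPERATOR-BOUND TOOLKIT for the pv21 covariant MODEL and the three ingredients of the
# parametrix remainder K(h)G′_□h of [B9] (3.88)–(3.90) for the k-fold tower operator: ℓ² bounds of ∇_U, of the Leibniz
# remainders ∂h·(·), of a general covariant block mean G and its transpose, and THE COMMUTATOR [GᵀG, M_φ] bounded by the
# BLOCK OSCILLATION of φ — all uniform in the transport U
# (unit `b2b-balaban-beta-d4-p2`, GEN 4; node (m1), first half, of `beta/skeletons/D4-NODE-O2-b2b-balaban-beta-d4-p2.md`)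

HONEST FRAMING: discharging `BetaPertH` makes Bałaban's UV stability UNCONDITIONAL — NOT the continuum limit, NOT the
Clay problem.  HONEST DEPENDENCY (verbatim): «continuum YM on T⁴ ⇐ BetaPertH ∧ nine spine estimates (0/9 proved);
BetaPertH ⇐ (D1) ∧ (D4) ∧ CAP+tail; G-an2-4 gates asym, D1 and NE2/3/4.»  THIS MODULE DISCHARGES NOTHING of `BetaPertH`,
asserts NOTHING printed and cites nothing as a fact (ABSOLUTE RULE): [folklore] finite-dimensional linear algebra about the
component MODEL of the pv21 chain `Literature/…/Balaban1983to89/B9Thm37GlueTorusCov*` ([B9] = `Balaban1985BackgroundPropagators`,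
Commun. Math. Phys. 99 (1985) 389–434; SHAPES: ∇_U (3.3), the covariant means (3.19), the Leibniz coefficient ∂h of K(h)
in (3.88) p. 409).

WHY.  pv21's `B9Thm37GlueTorusCovTowerPU` proves G′ = G′₀ + G′R′, R′ = Σ_□ K(h_□)G′_□h_□, for the tower operator with
K(h) = (leibRemT h)∇_U − ∇_U\*(leibRem h) + [M_h, Σ_l a_lG_lᵀG_l] CONCRETE, and claims «NO SMALLNESS of R′» ((3.89)/Thm 3.7:
«needs the decay of G′_□ and the ∂h_□ bounds»).  THIS FILE supplies the operator-norm ingredients of that smallness in ℓ²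
currency; the companion `CovariantTowerRemainder` assembles ‖K(h_□)G′_□h_□‖_{ℓ²→ℓ²} ≤ C/M₀ per box.

CONTENT (`L2Bound A C` := 0 ≤ C ∧ ∀ v, Σ (Av)² ≤ C²·Σ v²).
* §1 toolkit: `L2Bound.comp/add/neg/sub/smul/sum/mono/of_eq/transpose` (Cauchy–Schwarz), `l2Bound_mulOp` (|φ| ≤ m).
* §2 `l2Bound_covD` (‖∇_U‖ ≤ 2c_max√z), `l2Bound_covDT`; `l2Bound_leibRem` / `l2Bound_leibRemT` (‖∂h·(·)‖ ≤ θ√z when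
  |c(b)(h(b₊) − h(b₋))| ≤ θ).
* §3 `l2Bound_gMean` / `l2Bound_gMeanT` (‖G‖, ‖Gᵀ‖ ≤ w_max√n for site weights |W| ≤ w_max, isometric site transports, blocks
  of ≤ n sites), the intertwining identities `gMean_mulOp_apply` / `gMeanT_mulOp_apply` (G∘M_φ = M_φ̄∘G + G∘M_δ with φ̄ ANY
  block function and δ = φ − φ̄∘blk) and **`l2Bound_comm_gMeanSq`**: ‖(GᵀG∘M_φ − M_φ∘GᵀG)v‖ ≤ 2w_max²n·m·‖v‖ whenever
  |φ(x) − φ̄(blk x)| ≤ m — the block-OSCILLATION of φ, not its size, controls the commutator (transports enter only as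
  isometries).

NOT ASSERTED: anything printed; no (3.89); crude constants.  Row D4: RECORDS value (infrastructure of node (m1) = item (iii)
of the O.2 list); class of (T3)/NODE O.2 unchanged; D4 DISCHARGE NO DATE; NOT BetaPertH, NOT continuum, NOT Clay. -/

namespace Summit.QuantumFields.BalabanUV.Beta.CovariantTowerL2

open Finset
open Literature.MathematicalPhysics.QuantumFieldTheory.Balaban1983to89
open B9Thm37Sum B9Thm37Glue B9Thm37GlueTorusCov B9Thm37GlueTorusCovComp
open B9Thm37GlueTorusCovLevelsPoinc (sum_sq_orth_apply)
open B9Thm37GlueTorusCovCT (sum_sq_Rm_apply sum_comp_le_of_card_fiber_le)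
open Summit.QuantumFields.BalabanUV.Beta.CovariantTowerDecay (gtrT gMean_eq_sum_gtrT sum_blocks_sq_gtrT)

noncomputable section

/-! ## §1  ℓ² operator bounds -/

section Toolkit

variable {X Y Z : Type} [Fintype X] [Fintype Y] [Fintype Z]

/-- **ℓ² operator bound** (MODEL bookkeeping): `L2Bound A C` says C ≥ 0 and Σ_y (Av)(y)² ≤ C²·Σ_x v(x)² for all v.
[folklore] -/
def L2Bound (A : (X → ℝ) →ₗ[ℝ] (Y → ℝ)) (C : ℝ) : Prop := 0 ≤ C ∧ ∀ v : X → ℝ, ∑ y, A v y ^ 2 ≤ C ^ 2 * ∑ x, v x ^ 2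

namespace L2Bound

/-- The constant is ≥ 0. [folklore] -/
theorem nonneg {A : (X → ℝ) →ₗ[ℝ] (Y → ℝ)} {C : ℝ} (h : L2Bound A C) : 0 ≤ C := h.1

/-- Monotonicity in the constant. [folklore] -/
theorem mono {A : (X → ℝ) →ₗ[ℝ] (Y → ℝ)} {C C' : ℝ} (h : L2Bound A C) (hC : C ≤ C') : L2Bound A C' :=
  ⟨h.1.trans hC, fun v => (h.2 v).trans (mul_le_mul_of_nonneg_right (pow_le_pow_left₀ h.1 hC 2)
    (Finset.sum_nonneg fun _ _ => sq_nonneg _))⟩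

/-- Transfer along an equality of maps. [folklore] -/
theorem of_eq {A B : (X → ℝ) →ₗ[ℝ] (Y → ℝ)} {C : ℝ} (h : L2Bound A C) (e : A = B) : L2Bound B C := e ▸ h
/-- The zero map. [folklore] -/
theorem zero : L2Bound (0 : (X → ℝ) →ₗ[ℝ] (Y → ℝ)) 0 := ⟨le_rfl, fun v => by simp⟩

/-- Composition multiplies the constants. [folklore] -/
theorem comp {A : (X → ℝ) →ₗ[ℝ] (Y → ℝ)} {B : (Y → ℝ) →ₗ[ℝ] (Z → ℝ)} {CA CB : ℝ} (hB : L2Bound B CB)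
    (hA : L2Bound A CA) : L2Bound (B ∘ₗ A) (CB * CA) := by
  refine ⟨mul_nonneg hB.1 hA.1, fun v => ?_⟩
  rw [LinearMap.comp_apply, mul_pow]
  calc ∑ z, B (A v) z ^ 2 ≤ CB ^ 2 * ∑ y, A v y ^ 2 := hB.2 (A v)
    _ ≤ CB ^ 2 * (CA ^ 2 * ∑ x, v x ^ 2) := mul_le_mul_of_nonneg_left (hA.2 v) (sq_nonneg _)
    _ = CB ^ 2 * CA ^ 2 * ∑ x, v x ^ 2 := by ring

/-- Minkowski for finite sums: Σ(a+b)² ≤ (√Σa² + √Σb²)². [folklore] -/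
theorem sum_add_sq_le (a b : Y → ℝ) :
    ∑ y, (a y + b y) ^ 2 ≤ (Real.sqrt (∑ y, a y ^ 2) + Real.sqrt (∑ y, b y ^ 2)) ^ 2 := by
  have hA0 : 0 ≤ ∑ y, a y ^ 2 := Finset.sum_nonneg fun y _ => sq_nonneg _
  have hB0 : 0 ≤ ∑ y, b y ^ 2 := Finset.sum_nonneg fun y _ => sq_nonneg _
  have hcs : (∑ y, a y * b y) ^ 2 ≤ (∑ y, a y ^ 2) * ∑ y, b y ^ 2 := Finset.sum_mul_sq_le_sq_mul_sq univ a b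
  have hab : ∑ y, a y * b y ≤ Real.sqrt (∑ y, a y ^ 2) * Real.sqrt (∑ y, b y ^ 2) := by
    rw [← Real.sqrt_mul hA0]
    exact Real.le_sqrt_of_sq_le hcs
  have hexp : ∑ y, (a y + b y) ^ 2 = ∑ y, a y ^ 2 + 2 * ∑ y, a y * b y + ∑ y, b y ^ 2 := by
    rw [Finset.mul_sum, ← Finset.sum_add_distrib, ← Finset.sum_add_distrib]
    exact Finset.sum_congr rfl fun y _ => by ring
  rw [hexp, add_sq, Real.sq_sqrt hA0, Real.sq_sqrt hB0]
  nlinarith [hab]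

/-- Sums add the constants. [folklore] -/
theorem add {A B : (X → ℝ) →ₗ[ℝ] (Y → ℝ)} {CA CB : ℝ} (hA : L2Bound A CA) (hB : L2Bound B CB) :
    L2Bound (A + B) (CA + CB) := by
  refine ⟨add_nonneg hA.1 hB.1, fun v => ?_⟩
  have hv0 : 0 ≤ ∑ x, v x ^ 2 := Finset.sum_nonneg fun x _ => sq_nonneg _
  have ha : Real.sqrt (∑ y, A v y ^ 2) ≤ CA * Real.sqrt (∑ x, v x ^ 2) := by
    rw [← Real.sqrt_sq hA.1, ← Real.sqrt_mul (sq_nonneg _)]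
    exact Real.sqrt_le_sqrt (hA.2 v)
  have hb : Real.sqrt (∑ y, B v y ^ 2) ≤ CB * Real.sqrt (∑ x, v x ^ 2) := by
    rw [← Real.sqrt_sq hB.1, ← Real.sqrt_mul (sq_nonneg _)]
    exact Real.sqrt_le_sqrt (hB.2 v)
  have hs0 : 0 ≤ Real.sqrt (∑ y, A v y ^ 2) + Real.sqrt (∑ y, B v y ^ 2) :=
    add_nonneg (Real.sqrt_nonneg _) (Real.sqrt_nonneg _)
  calc ∑ y, (A + B) v y ^ 2 = ∑ y, (A v y + B v y) ^ 2 := by simp only [LinearMap.add_apply, Pi.add_apply]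
    _ ≤ (Real.sqrt (∑ y, A v y ^ 2) + Real.sqrt (∑ y, B v y ^ 2)) ^ 2 := sum_add_sq_le _ _
    _ ≤ ((CA + CB) * Real.sqrt (∑ x, v x ^ 2)) ^ 2 :=
        pow_le_pow_left₀ hs0 (by rw [add_mul]; exact add_le_add ha hb) 2
    _ = (CA + CB) ^ 2 * ∑ x, v x ^ 2 := by rw [mul_pow, Real.sq_sqrt hv0]

/-- Negation keeps the constant. [folklore] -/
theorem neg {A : (X → ℝ) →ₗ[ℝ] (Y → ℝ)} {C : ℝ} (hA : L2Bound A C) : L2Bound (-A) C :=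
  ⟨hA.1, fun v => by simpa only [LinearMap.neg_apply, Pi.neg_apply, neg_sq] using hA.2 v⟩

/-- Differences add the constants. [folklore] -/
theorem sub {A B : (X → ℝ) →ₗ[ℝ] (Y → ℝ)} {CA CB : ℝ} (hA : L2Bound A CA) (hB : L2Bound B CB) :
    L2Bound (A - B) (CA + CB) := by
  rw [sub_eq_add_neg]
  exact hA.add hB.neg

/-- Scalar multiples scale the constant by |r|. [folklore] -/
theorem smul {A : (X → ℝ) →ₗ[ℝ] (Y → ℝ)} {C : ℝ} (hA : L2Bound A C) (r : ℝ) : L2Bound (r • A) (|r| * C) := by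
  refine ⟨mul_nonneg (abs_nonneg _) hA.1, fun v => ?_⟩
  calc ∑ y, (r • A) v y ^ 2 = r ^ 2 * ∑ y, A v y ^ 2 := by
        rw [Finset.mul_sum]
        exact Finset.sum_congr rfl fun y _ => by simp only [LinearMap.smul_apply, Pi.smul_apply, smul_eq_mul]; ring
    _ ≤ r ^ 2 * (C ^ 2 * ∑ x, v x ^ 2) := mul_le_mul_of_nonneg_left (hA.2 v) (sq_nonneg _)
    _ = (|r| * C) ^ 2 * ∑ x, v x ^ 2 := by rw [mul_pow, sq_abs]; ring

/-- Finite sums add the constants. [folklore] -/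
theorem sum {ι : Type} (s : Finset ι) {A : ι → (X → ℝ) →ₗ[ℝ] (Y → ℝ)} {C : ι → ℝ}
    (h : ∀ i ∈ s, L2Bound (A i) (C i)) : L2Bound (∑ i ∈ s, A i) (∑ i ∈ s, C i) := by
  classical
  induction s using Finset.induction_on with
  | empty => simpa using (zero : L2Bound (0 : (X → ℝ) →ₗ[ℝ] (Y → ℝ)) 0)
  | insert i s hi ih =>
      rw [Finset.sum_insert hi, Finset.sum_insert hi]
      exact (h i (Finset.mem_insert_self i s)).add (ih fun j hj => h j (Finset.mem_insert_of_mem hj))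

/-- **A transpose pair inherits the bound**: if Σ_y (Au)(y)w(y) = Σ_x u(x)(Bw)(x) for all u, w and ‖A‖ ≤ C then
‖B‖ ≤ C (Cauchy–Schwarz on ‖Bw‖² = ⟨A(Bw), w⟩). [folklore] -/
theorem transpose {A : (X → ℝ) →ₗ[ℝ] (Y → ℝ)} {B : (Y → ℝ) →ₗ[ℝ] (X → ℝ)} {C : ℝ} (hAB : IsTransposePair A B)
    (hA : L2Bound A C) : L2Bound B C := by
  refine ⟨hA.1, fun w => ?_⟩
  set S := ∑ x, B w x ^ 2 with hS
  have hS0 : 0 ≤ S := Finset.sum_nonneg fun x _ => sq_nonneg _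
  have hw0 : 0 ≤ ∑ y, w y ^ 2 := Finset.sum_nonneg fun y _ => sq_nonneg _
  have hdual : S = ∑ y, A (B w) y * w y := by
    rw [hAB (B w) w, hS]
    exact Finset.sum_congr rfl fun x _ => sq _
  have hcs : (∑ y, A (B w) y * w y) ^ 2 ≤ (∑ y, A (B w) y ^ 2) * ∑ y, w y ^ 2 :=
    Finset.sum_mul_sq_le_sq_mul_sq univ _ _
  have h2 : S ^ 2 ≤ C ^ 2 * S * ∑ y, w y ^ 2 := by
    calc S ^ 2 = (∑ y, A (B w) y * w y) ^ 2 := by rw [hdual]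
      _ ≤ (∑ y, A (B w) y ^ 2) * ∑ y, w y ^ 2 := hcs
      _ ≤ (C ^ 2 * S) * ∑ y, w y ^ 2 := mul_le_mul_of_nonneg_right (hA.2 (B w)) hw0
      _ = C ^ 2 * S * ∑ y, w y ^ 2 := by ring
  rcases hS0.eq_or_lt with h0 | hpos
  · rw [← h0]; exact mul_nonneg (sq_nonneg _) hw0
  · have : S * S ≤ (C ^ 2 * ∑ y, w y ^ 2) * S := by nlinarith
    exact le_of_mul_le_mul_right this hpos

end L2Bound

/-- **Multiplication operators**: |φ| ≤ m (m ≥ 0) ⇒ ‖M_φ‖ ≤ m. [folklore] -/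
theorem l2Bound_mulOp {φ : X → ℝ} {m : ℝ} (hm : 0 ≤ m) (hφ : ∀ x, |φ x| ≤ m) : L2Bound (mulOp φ) m := by
  refine ⟨hm, fun v => ?_⟩
  rw [Finset.mul_sum]
  refine Finset.sum_le_sum fun x _ => ?_
  rw [mulOp_apply, mul_pow]
  exact mul_le_mul_of_nonneg_right (by rw [← sq_abs (φ x)]; exact pow_le_pow_left₀ (abs_nonneg _) (hφ x) 2)
    (sq_nonneg _)

end Toolkit

/-! ## §2  ∇_U, ∇_U\* and the Leibniz remainders -/

section Derivative

variable {St Bd Cp : Type} [Fintype St] [DecidableEq St] [Fintype Bd] [Fintype Cp] [DecidableEq Cp]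
  (src tgt : Bd → St) (c : Bd → ℝ) (Rm : Bd → Cp → Cp → ℝ)

omit [DecidableEq St] [DecidableEq Cp] in
/-- Site energies sum to the field energy: Σ_x Σ_k v(x,k)² = Σ_p v(p)². [folklore] -/
theorem sum_site_sq (v : St × Cp → ℝ) : ∑ x, ∑ k, v (x, k) ^ 2 = ∑ p, v p ^ 2 :=
  (Fintype.sum_prod_type (fun p : St × Cp => v p ^ 2)).symm

/-- **‖∇_U‖ ≤ 2c_max√z** (isometric bond matrices, |c(b)| ≤ c_max, c_max ≥ 0, at most z bonds start resp. end at a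
site):  Σ_q (∇_Uv)(q)² ≤ 4c_max²z·Σ_p v(p)². [folklore] -/
theorem l2Bound_covD (hRm : ∀ b i j, ∑ k, Rm b k i * Rm b k j = if i = j then (1 : ℝ) else 0)
    {cmax : ℝ} (hcmax : 0 ≤ cmax) (hc' : ∀ b, |c b| ≤ cmax) {z : ℕ}
    (hzs : ∀ x, (univ.filter fun b => src b = x).card ≤ z) (hzt : ∀ x, (univ.filter fun b => tgt b = x).card ≤ z) :
    L2Bound (covD src tgt c Rm) (2 * cmax * Real.sqrt z) := by
  classical
  refine ⟨by positivity, fun v => ?_⟩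
  have hF0 : ∀ x, 0 ≤ (fun x => ∑ k, v (x, k) ^ 2) x := fun x => Finset.sum_nonneg fun k _ => sq_nonneg _
  have hterm : ∀ b : Bd, ∑ k, covD src tgt c Rm v (b, k) ^ 2 ≤
      2 * cmax ^ 2 * ((∑ k, v (tgt b, k) ^ 2) + ∑ k, v (src b, k) ^ 2) := by
    intro b
    have hsq : c b ^ 2 ≤ cmax ^ 2 := by
      rw [← sq_abs (c b)]; exact pow_le_pow_left₀ (abs_nonneg _) (hc' b) 2
    have hnn : 0 ≤ (∑ k, v (tgt b, k) ^ 2) + ∑ k, v (src b, k) ^ 2 :=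
      add_nonneg (Finset.sum_nonneg fun k _ => sq_nonneg _) (Finset.sum_nonneg fun k _ => sq_nonneg _)
    calc ∑ k, covD src tgt c Rm v (b, k) ^ 2
        = c b ^ 2 * ∑ k, ((∑ j, Rm b k j * v (tgt b, j)) - v (src b, k)) ^ 2 := by
          rw [Finset.mul_sum]
          exact Finset.sum_congr rfl fun k _ => by rw [covD_apply]; ring
      _ ≤ c b ^ 2 * ∑ k, 2 * ((∑ j, Rm b k j * v (tgt b, j)) ^ 2 + v (src b, k) ^ 2) := by
          refine mul_le_mul_of_nonneg_left (Finset.sum_le_sum fun k _ => ?_) (sq_nonneg _)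
          nlinarith [sq_nonneg ((∑ j, Rm b k j * v (tgt b, j)) + v (src b, k))]
      _ = 2 * c b ^ 2 * ((∑ k, v (tgt b, k) ^ 2) + ∑ k, v (src b, k) ^ 2) := by
          rw [← Finset.mul_sum, Finset.sum_add_distrib, sum_sq_Rm_apply Rm hRm b (fun j => v (tgt b, j))]
          ring
      _ ≤ 2 * cmax ^ 2 * ((∑ k, v (tgt b, k) ^ 2) + ∑ k, v (src b, k) ^ 2) :=
          mul_le_mul_of_nonneg_right (by nlinarith) hnn
  have htgt := sum_comp_le_of_card_fiber_le tgt hzt (fun x => ∑ k, v (x, k) ^ 2) hF0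
  have hsrc := sum_comp_le_of_card_fiber_le src hzs (fun x => ∑ k, v (x, k) ^ 2) hF0
  have hS0 : 0 ≤ ∑ x, ∑ k, v (x, k) ^ 2 := Finset.sum_nonneg fun x _ => hF0 x
  calc ∑ q, covD src tgt c Rm v q ^ 2 = ∑ b, ∑ k, covD src tgt c Rm v (b, k) ^ 2 :=
        Fintype.sum_prod_type _
    _ ≤ ∑ b, 2 * cmax ^ 2 * ((∑ k, v (tgt b, k) ^ 2) + ∑ k, v (src b, k) ^ 2) :=
        Finset.sum_le_sum fun b _ => hterm b
    _ = 2 * cmax ^ 2 * (∑ b, (∑ k, v (tgt b, k) ^ 2) + ∑ b, ∑ k, v (src b, k) ^ 2) := by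
        rw [← Finset.sum_add_distrib, Finset.mul_sum]
    _ ≤ 2 * cmax ^ 2 * (z * ∑ x, ∑ k, v (x, k) ^ 2 + z * ∑ x, ∑ k, v (x, k) ^ 2) :=
        mul_le_mul_of_nonneg_left (add_le_add htgt hsrc) (by positivity)
    _ = (2 * cmax * Real.sqrt z) ^ 2 * ∑ p, v p ^ 2 := by
        rw [sum_site_sq, mul_pow, mul_pow, Real.sq_sqrt (Nat.cast_nonneg z)]; ring

/-- **‖∇_U\*‖ ≤ 2c_max√z** (transpose of `l2Bound_covD`). [folklore] -/
theorem l2Bound_covDT (hRm : ∀ b i j, ∑ k, Rm b k i * Rm b k j = if i = j then (1 : ℝ) else 0)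
    {cmax : ℝ} (hcmax : 0 ≤ cmax) (hc' : ∀ b, |c b| ≤ cmax) {z : ℕ}
    (hzs : ∀ x, (univ.filter fun b => src b = x).card ≤ z) (hzt : ∀ x, (univ.filter fun b => tgt b = x).card ≤ z) :
    L2Bound (covDT src tgt c Rm) (2 * cmax * Real.sqrt z) :=
  (l2Bound_covD src tgt c Rm hRm hcmax hc' hzs hzt).transpose (isTransposePair_covD src tgt c Rm)

omit [DecidableEq Cp] in
/-- **‖∂h·(·)‖ ≤ θ√z**: if |c(b)(h(b₊) − h(b₋))| ≤ θ (θ ≥ 0) and at most z bonds start at a site, the Leibniz remainder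
(leibRem h f)(b, k) = c(b)(h(b₊) − h(b₋))f(b₋, k) satisfies Σ_q (leibRem h f)(q)² ≤ θ²z·Σ_p f(p)². [folklore] -/
theorem l2Bound_leibRem (h : St → ℝ) {θ : ℝ} (hθ : 0 ≤ θ) (hdh : ∀ b, |c b * (h (tgt b) - h (src b))| ≤ θ) {z : ℕ}
    (hzs : ∀ x, (univ.filter fun b => src b = x).card ≤ z) :
    L2Bound (leibRem (Cp := Cp) src tgt c h) (θ * Real.sqrt z) := by
  classical
  refine ⟨by positivity, fun v => ?_⟩
  have hF0 : ∀ x, 0 ≤ (fun x => ∑ k, v (x, k) ^ 2) x := fun x => Finset.sum_nonneg fun k _ => sq_nonneg _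
  have hterm : ∀ b : Bd, ∑ k, leibRem (Cp := Cp) src tgt c h v (b, k) ^ 2 ≤ θ ^ 2 * ∑ k, v (src b, k) ^ 2 := by
    intro b
    have hsq : (c b * (h (tgt b) - h (src b))) ^ 2 ≤ θ ^ 2 := by
      rw [← sq_abs (c b * _)]; exact pow_le_pow_left₀ (abs_nonneg _) (hdh b) 2
    rw [Finset.mul_sum]
    refine Finset.sum_le_sum fun k _ => ?_
    rw [leibRem_apply, mul_pow]
    exact mul_le_mul_of_nonneg_right hsq (sq_nonneg _)
  have hsrc := sum_comp_le_of_card_fiber_le src hzs (fun x => ∑ k, v (x, k) ^ 2) hF0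
  calc ∑ q, leibRem (Cp := Cp) src tgt c h v q ^ 2 = ∑ b, ∑ k, leibRem (Cp := Cp) src tgt c h v (b, k) ^ 2 :=
        Fintype.sum_prod_type _
    _ ≤ ∑ b, θ ^ 2 * ∑ k, v (src b, k) ^ 2 := Finset.sum_le_sum fun b _ => hterm b
    _ = θ ^ 2 * ∑ b, ∑ k, v (src b, k) ^ 2 := by rw [Finset.mul_sum]
    _ ≤ θ ^ 2 * (z * ∑ x, ∑ k, v (x, k) ^ 2) := mul_le_mul_of_nonneg_left hsrc (sq_nonneg _)
    _ = (θ * Real.sqrt z) ^ 2 * ∑ p, v p ^ 2 := by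
        rw [sum_site_sq, mul_pow, Real.sq_sqrt (Nat.cast_nonneg z)]; ring

omit [DecidableEq Cp] in
/-- **‖(∂h·(·))ᵀ‖ ≤ θ√z** (transpose, `isTransposePair_leibRemT`). [folklore] -/
theorem l2Bound_leibRemT (h : St → ℝ) {θ : ℝ} (hθ : 0 ≤ θ) (hdh : ∀ b, |c b * (h (tgt b) - h (src b))| ≤ θ)
    {z : ℕ} (hzs : ∀ x, (univ.filter fun b => src b = x).card ≤ z) :
    L2Bound (leibRemT (Cp := Cp) src tgt c h) (θ * Real.sqrt z) :=
  (l2Bound_leibRem src tgt c h hθ hdh hzs).transpose (isTransposePair_leibRemT src tgt c h).symm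

end Derivative

/-! ## §3  A general covariant block mean: ‖G‖, ‖Gᵀ‖ and the commutator [GᵀG, M_φ] by the block oscillation of φ -/

section Mean

variable {St B Cp : Type} [Fintype St] [Fintype B] [DecidableEq B] [Fintype Cp] [DecidableEq Cp]
  (blk : St → B) (W : St → ℝ) (T : St → Cp → Cp → ℝ)

/-- **‖G‖ ≤ w_max√n** for G = `gMean blk W T` with |W| ≤ w_max (w_max ≥ 0), isometric site transports and blocks of at
most n sites: Σ_q (Gf)(q)² ≤ w_max²n·Σ_p f(p)². [folklore] -/
theorem l2Bound_gMean {wmax : ℝ} (hwmax : 0 ≤ wmax) (hW : ∀ x, |W x| ≤ wmax)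
    (hT : ∀ x i i', ∑ k, T x k i * T x k i' = if i = i' then (1 : ℝ) else 0)
    {n : ℕ} (hn : ∀ β, (univ.filter fun x => blk x = β).card ≤ n) :
    L2Bound (gMean blk W T) (wmax * Real.sqrt n) := by
  refine ⟨by positivity, fun v => ?_⟩
  have hterm : ∀ β i, gMean blk W T v (β, i) ^ 2 ≤
      wmax ^ 2 * n * ∑ x ∈ univ.filter (fun x => blk x = β), gtrT T v x i ^ 2 := by
    intro β i
    set s := univ.filter (fun x => blk x = β) with hs
    rw [gMean_eq_sum_gtrT]
    have h1 : (∑ x ∈ s, W x * gtrT T v x i) ^ 2 ≤ (∑ x ∈ s, |W x * gtrT T v x i|) ^ 2 := by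
      rw [← sq_abs (∑ x ∈ s, _)]
      exact pow_le_pow_left₀ (abs_nonneg _) (Finset.abs_sum_le_sum_abs _ _) 2
    have h2 : (∑ x ∈ s, |W x * gtrT T v x i|) ^ 2 ≤ s.card * ∑ x ∈ s, |W x * gtrT T v x i| ^ 2 :=
      sq_sum_le_card_mul_sum_sq
    have h3 : ∑ x ∈ s, |W x * gtrT T v x i| ^ 2 ≤ ∑ x ∈ s, wmax ^ 2 * gtrT T v x i ^ 2 :=
      Finset.sum_le_sum fun x _ => by
        rw [abs_mul, mul_pow, sq_abs (gtrT T v x i)]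
        exact mul_le_mul_of_nonneg_right (pow_le_pow_left₀ (abs_nonneg _) (hW x) 2) (sq_nonneg _)
    have h4 : 0 ≤ ∑ x ∈ s, wmax ^ 2 * gtrT T v x i ^ 2 :=
      Finset.sum_nonneg fun x _ => mul_nonneg (sq_nonneg _) (sq_nonneg _)
    calc (∑ x ∈ s, W x * gtrT T v x i) ^ 2 ≤ s.card * ∑ x ∈ s, |W x * gtrT T v x i| ^ 2 := h1.trans h2
      _ ≤ n * ∑ x ∈ s, wmax ^ 2 * gtrT T v x i ^ 2 :=
          mul_le_mul (by exact_mod_cast hn β) h3 (Finset.sum_nonneg fun x _ => sq_nonneg _) (Nat.cast_nonneg _)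
      _ = wmax ^ 2 * n * ∑ x ∈ s, gtrT T v x i ^ 2 := by rw [← Finset.mul_sum]; ring
  calc ∑ q, gMean blk W T v q ^ 2 = ∑ β, ∑ i, gMean blk W T v (β, i) ^ 2 := Fintype.sum_prod_type _
    _ ≤ ∑ β, ∑ i, wmax ^ 2 * n * ∑ x ∈ univ.filter (fun x => blk x = β), gtrT T v x i ^ 2 :=
        Finset.sum_le_sum fun β _ => Finset.sum_le_sum fun i _ => hterm β i
    _ = wmax ^ 2 * n * ∑ p, v p ^ 2 := by
        rw [← sum_blocks_sq_gtrT blk hT v, Finset.mul_sum]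
        exact Finset.sum_congr rfl fun β _ => by rw [Finset.mul_sum]
    _ = (wmax * Real.sqrt n) ^ 2 * ∑ p, v p ^ 2 := by rw [mul_pow, Real.sq_sqrt (Nat.cast_nonneg n)]

/-- **‖Gᵀ‖ ≤ w_max√n** (transpose, `isTransposePair_gMean`). [folklore] -/
theorem l2Bound_gMeanT {wmax : ℝ} (hwmax : 0 ≤ wmax) (hW : ∀ x, |W x| ≤ wmax)
    (hT : ∀ x i i', ∑ k, T x k i * T x k i' = if i = i' then (1 : ℝ) else 0)
    {n : ℕ} (hn : ∀ β, (univ.filter fun x => blk x = β).card ≤ n) :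
    L2Bound (gMeanT blk W T) (wmax * Real.sqrt n) :=
  (l2Bound_gMean blk W T hwmax hW hT hn).transpose (isTransposePair_gMean blk W T)

omit [Fintype B] [DecidableEq Cp] in
/-- **G intertwines M_φ and M_φ̄ up to the block deviation**: for ANY block function φ̄ and δ := φ − φ̄∘blk,
G(φ·f)(β, i) = φ̄(β)·(Gf)(β, i) + G(δ·f)(β, i). [folklore] -/
theorem gMean_mulOp_apply (φ : St → ℝ) (φb : B → ℝ) (f : St × Cp → ℝ) (q : B × Cp) :
    gMean blk W T (mulOp (φ ∘ Prod.fst) f) q =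
      φb q.1 * gMean blk W T f q + gMean blk W T (mulOp ((fun x => φ x - φb (blk x)) ∘ Prod.fst) f) q := by
  rw [gMean_apply, gMean_apply, gMean_apply, Finset.mul_sum, ← Finset.sum_add_distrib]
  refine Finset.sum_congr rfl fun x _ => ?_
  split_ifs with hx
  · simp only [mulOp_apply, Function.comp_apply]
    rw [← hx, Finset.mul_sum, Finset.mul_sum, Finset.mul_sum, Finset.mul_sum, ← Finset.sum_add_distrib]
    exact Finset.sum_congr rfl fun j _ => by ring
  · simp

omit [Fintype St] [Fintype B] [DecidableEq B] [DecidableEq Cp] in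
/-- **Gᵀ intertwines M_φ̄ and M_φ up to the block deviation**: φ(x)·(Gᵀh)(x, j) = (Gᵀ(φ̄·h))(x, j) + δ(x)·(Gᵀh)(x, j).
[folklore] -/
theorem gMeanT_mulOp_apply (φ : St → ℝ) (φb : B → ℝ) (hh : B × Cp → ℝ) (p : St × Cp) :
    φ p.1 * gMeanT blk W T hh p =
      gMeanT blk W T (mulOp (φb ∘ Prod.fst) hh) p + (φ p.1 - φb (blk p.1)) * gMeanT blk W T hh p := by
  rw [gMeanT_apply, gMeanT_apply]
  have e : ∑ i, T p.1 i p.2 * mulOp (φb ∘ Prod.fst) hh (blk p.1, i) =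
      φb (blk p.1) * ∑ i, T p.1 i p.2 * hh (blk p.1, i) := by
    rw [Finset.mul_sum]
    exact Finset.sum_congr rfl fun i _ => by simp only [mulOp_apply, Function.comp_apply]; ring
  rw [e]
  ring

/-- **THE COMMUTATOR [GᵀG, M_φ] IS CONTROLLED BY THE BLOCK OSCILLATION OF φ (MODEL)**: with G = `gMean blk W T`
(|W| ≤ w_max, isometric transports, blocks ≤ n sites) and ANY block function φ̄ with |φ(x) − φ̄(blk x)| ≤ m (m ≥ 0):
‖(GᵀG∘M_φ − M_φ∘GᵀG)v‖ ≤ 2w_max²n·m·‖v‖, because GᵀG∘M_φ − M_φ∘GᵀG = GᵀG∘M_δ − M_δ∘GᵀG, δ = φ − φ̄∘blk. [folklore] -/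
theorem l2Bound_comm_gMeanSq {wmax : ℝ} (hwmax : 0 ≤ wmax) (hW : ∀ x, |W x| ≤ wmax)
    (hT : ∀ x i i', ∑ k, T x k i * T x k i' = if i = i' then (1 : ℝ) else 0)
    {n : ℕ} (hn : ∀ β, (univ.filter fun x => blk x = β).card ≤ n) (φ : St → ℝ) (φb : B → ℝ) {m : ℝ}
    (hm : 0 ≤ m) (hδ : ∀ x, |φ x - φb (blk x)| ≤ m) :
    L2Bound ((gMeanT blk W T ∘ₗ gMean blk W T) ∘ₗ mulOp (φ ∘ Prod.fst) -
        mulOp (φ ∘ Prod.fst) ∘ₗ (gMeanT blk W T ∘ₗ gMean blk W T)) (2 * (wmax ^ 2 * n) * m) := by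
  set G := gMean blk W T with hGdef
  set Gt := gMeanT blk W T with hGtdef
  set δ : St → ℝ := fun x => φ x - φb (blk x) with hδdef
  have hG : L2Bound G (wmax * Real.sqrt n) := l2Bound_gMean blk W T hwmax hW hT hn
  have hGt : L2Bound Gt (wmax * Real.sqrt n) := l2Bound_gMeanT blk W T hwmax hW hT hn
  have hQ : L2Bound (Gt ∘ₗ G) (wmax ^ 2 * n) := by
    have h := hGt.comp hG
    have e : wmax * Real.sqrt n * (wmax * Real.sqrt n) = wmax ^ 2 * n := by
      rw [mul_mul_mul_comm, Real.mul_self_sqrt (Nat.cast_nonneg n)]; ring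
    rwa [e] at h
  have hMδ : L2Bound (mulOp (δ ∘ Prod.fst) : Module.End ℝ (St × Cp → ℝ)) m :=
    l2Bound_mulOp hm fun p => hδ p.1
  -- the two intertwining identities as function identities
  have e1 : ∀ v : St × Cp → ℝ, G (mulOp (φ ∘ Prod.fst) v) = mulOp (φb ∘ Prod.fst) (G v) + G (mulOp (δ ∘ Prod.fst) v) :=
    fun v => funext fun q => by
      rw [Pi.add_apply, mulOp_apply, Function.comp_apply, hGdef, gMean_mulOp_apply blk W T φ φb v q]
  have e2 : ∀ (w : B × Cp → ℝ) (p : St × Cp),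
      Gt (mulOp (φb ∘ Prod.fst) w) p = φ p.1 * Gt w p - δ p.1 * Gt w p := fun w p => by
    rw [hGtdef, gMeanT_mulOp_apply blk W T φ φb w p]
    ring
  -- the commutator equals GᵀG∘M_δ − M_δ∘GᵀG
  have hcomm : (Gt ∘ₗ G) ∘ₗ mulOp (φ ∘ Prod.fst) - mulOp (φ ∘ Prod.fst) ∘ₗ (Gt ∘ₗ G) =
      (Gt ∘ₗ G) ∘ₗ mulOp (δ ∘ Prod.fst) - mulOp (δ ∘ Prod.fst) ∘ₗ (Gt ∘ₗ G) := by
    apply LinearMap.ext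
    intro v
    funext p
    simp only [LinearMap.sub_apply, LinearMap.comp_apply, Pi.sub_apply, mulOp_apply, Function.comp_apply]
    rw [e1, map_add, Pi.add_apply, e2]
    ring
  have hb := ((hQ.comp hMδ).sub (hMδ.comp hQ)).of_eq hcomm.symm
  refine hb.mono (le_of_eq ?_)
  ring

end Mean

end

end Summit.QuantumFields.BalabanUV.Beta.CovariantTowerL2
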